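import Summits.BirchSwinnertonDyer.BirchSwinnertonDyer.Theorems.ByReductionTypeAtTwoMultSelmerRankDisplay
import Summits.BirchSwinnertonDyer.BirchSwinnertonDyer.Theorems.ByReductionTypeAtTwoMultLowerHalfSelmerRankSplitKappa
import Summits.BirchSwinnertonDyer.BirchSwinnertonDyer.Theorems.ByReductionTypeAtTwoMultTowerPinchSplitGSFree
import HarnessLib

/-!
# Route `ByReductionTypeAtTwo`, children `MultLowerHalfAtTwo` (item stmt-BirchSwinnertonDyer-19923) /
# `MultUpperHalfAtTwo` (19922): the two SPLIT DISPLAY-FORM rows of `…MultSelmerRankDisplay.lean` (GEN 6, p447774)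
# WITHOUT `greenberg_stevens W 2` — `hper₀ := Česnavičius`, `htors := surjectivity / irreducibility`, `hGS := κ₁`

HONEST FRAMING (cell `bsd-2adic`, run/shared/lean/pub/bsd-2adic/, seat `bsd-2adic-mult-3` GEN 7, HUMAN RULINGS
D-0036 / D-0054 / D-0074 row (A)): research route; THEOREMS ONLY — nothing asserted, nothing booked; BSD is not
proved by any of this. PARTITION (D-0054): X5@2 mult, SPLIT, `E[2]` irreducible (K4ᵐ, B1·O1: the 36 split `Δ > 0`
tier-1 classes of the slack-one face, and the split habitat of the TOWER λ-pinch road) × p = 2 — types-the-object-of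
(BSD₂ row displays ⇒ items 19923 / 19922 at the class); closes none.

WHAT THIS FILE DOES. `…MultSelmerRankDisplay.lean` §2/§3 give the row DISPLAY forms (period datum `hper₀` discharged
by Česnavičius `hC` on the irreducible locus, torsion side condition by the surjectivity / irreducibility datum) of
the split slack-one door and of the split TOWER λ-pinch door — both still with `hGS`. Their GS-free twins, one
application each of the `κ₁`-certificate doors landed this GEN (`…SelmerRankSplitKappa.lean` p462280,
`…TowerPinchSplitGSFree.lean`):
* `bsdp_two_split_of_katoUpToOnePinch_of_mu_display_of_kappaCert` — PRINT {A236 `h41`, `hmod`, `hGZK`, `h414`, `hC`}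
  + MEMO {slack-one `hK1sp`} + HYPOTHESIS `hμX` + CERT {`hκ`, `hlan`, `hμan`, `hsel`} + {`Mult`, split,
  `TwoAdicSurjective`} + `r_an = 0`;
* `bsdp_two_split_of_katoRat_of_towerGap_display_of_kappaCert` — PRINT {A236, `hmod`, `hGZK`, `h414`, `hC`} + MEMO
  {K11 `hKato`} + CERT {`hκ`, tower gap, layer count, `λ_an = n + 1`, `μ_an = 0`} + `Irr W 2` + {`Mult`, split,
  `r_an = 0`}.
Implied by the `hGS` originals (`X5.O1.analyticKappaOneValuationAtTwo_of_greenbergStevens`).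
References: R. Greenberg, LNM 1716 (1999), §4 pp. 112–113, Prop. 4.14 (p. 124); K. Česnavičius, Compositio Math.
154 (2018), Thm. 1.2; K. Kato, Astérisque 295 (2004), Thm. 17.4/17.13; B. Mazur, J. Tate, J. Teitelbaum, Invent.
Math. 84 (1986), §I.13–15, §II; R. L. Miller, LMS J. Comput. Math. 14 (2011), Def. 1.1.
-/

set_option autoImplicit false
-- the route's Theorems namespace repeats a component by design (summit = sub-problem, D-0017 nested layout)
set_option linter.dupNamespace false

noncomputable section

open scoped Classical MatrixGroups ModularForm

open CongruenceSubgroup WeierstrassCurve Literature.NumberTheory.EllipticCurves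
  Literature.NumberTheory.EllipticCurves.ModularForms
  Literature.NumberTheory.EllipticCurves.Greenberg1999
  Literature.NumberTheory.EllipticCurves.Rank1Residual
  Literature.NumberTheory.EllipticCurves.Rank1Residual.Typed
  Summit.BirchSwinnertonDyer.Rank1Residual
  Summit.BirchSwinnertonDyer.Rank1Residual.X5 Summit.BirchSwinnertonDyer.Rank1Residual.X5.O1

namespace Summit.BirchSwinnertonDyer.BirchSwinnertonDyer.Theorems.MultSelmerRank

variable (W : WeierstrassCurve ℚ) [W.IsElliptic] [W.IsGloballyMinimal]

/-- **TIER-1 SPLIT `Δ > 0` ROW, DISPLAY FORM, on the `κ₁`-CERTIFICATE: `BSDp W 2`** from PRINT {A236 `h41`, `hmod`,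
`hGZK`, `h414`, `hC`} + MEMO {the slack-one datum `hK1sp`} + the HYPOTHESIS `hμX` (`μ(X) = 0`, displayed) + CERT
{`hκ`, `hlan` (`n + 1`), `hμan`, `hsel`} + decidable {`Mult W 2`, split, `TwoAdicSurjective W`} + `r_an = 0`;
`htors` and `hper₀` discharged from the surjectivity certificate and `hC` (GEN 6 §0). No `hGS`.
[cite: GreenbergLNM1716, §4 pp. 112–113 (split l_v), Conj. 1.11 and Prop. 4.14 (p. 124)] [cite: Cesnavicius2018, Thm. 1.2]
[cite: MazurTateTeitelbaum1986Invent, §I.10, §I.13–15 and §II] [cite: Miller2011LMS, Def. 1.1 and §1] -/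
theorem bsdp_two_split_of_katoUpToOnePinch_of_mu_display_of_kappaCert {j n : ℕ}
    (h41 : thm41Analogue_charValue_rankZero_split_baseChange_anyPrime)
    (hκ : AnalyticKappaOneValuationAtTwo W)
    (hmod : nonempty_modularParametrizationData)
    (hGZK : rank_eq_analyticRank_of_analyticRank_le_one)
    (h414 : prop414_noFiniteSubmodule_of_not_dvd_torsionOrder)
    (hC : cesnavicius_not_two_dvd_maninConstant_of_two_dvd_level)
    (hK1sp : ∀ (κ : ZpExtension ℚ 2) (γ : Field.absoluteGaloisGroup ℚ), κ.IsCyclotomic →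
      κ.IsTopGenerator γ → IsCyclotomicVariable 2 γ →
      ∀ [NeZero (W.conductorNorm ℤ)] (f : CuspForm (Gamma0 (W.conductorNorm ℤ)) 2), IsNewformOf W f →
      ∀ ϖ : ℚ, (ϖ : ℝ) * W.realPeriodRat = plusPeriod f →
      ∀ L : PowerSeries ℚ_[2], IsSplitMultPAdicLFunctionOf f 2 L → ∀ D : W.SelmerDualData κ γ,
        D.IsTorsion ∧ ∃ g ∈ D.charIdeal,
          iwasawaToPowerSeries 2 (PowerSeries.X * g) = PowerSeries.C ((2 * ϖ : ℚ) : ℚ_[2]) * L)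
    (hμX : ∀ (κ : ZpExtension ℚ 2) (γ : Field.absoluteGaloisGroup ℚ), κ.IsCyclotomic →
      κ.IsTopGenerator γ → IsCyclotomicVariable 2 γ → ∀ D : W.SelmerDualData κ γ, D.IsTorsion → D.mu = 0)
    (hr : W.analyticRank = 0) (hmult : Mult W 2) (hsp : W.HasSplitMultiplicativeReductionAtPrime 2)
    (him : TwoAdicSurjective W)
    (hlan : X2.AnalyticLambdaEq W 2 (n + 1)) (hμan : X2.AnalyticMuLE W 2 0)
    (hsel : ∀ κ : ZpExtension ℚ 2, κ.IsCyclotomic →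
      2 ^ n ≤ Nat.card {z : W.selmerLayer κ j // 2 • z = 0}) : BSDp W 2 :=
  bsdp_two_split_of_katoUpToOnePinch_of_mu_of_layerSelmer_of_kappaCert W h41 hκ hmod hGZK h414 hK1sp hμX
    (periodRatio_nonneg_of_twoAdicSurjective_of_cesnavicius W hC hmult him)
    (not_two_dvd_torsionOrder_of_twoAdicSurjective W him) hr hmult hsp hlan hμan hsel

/-- **TOWER λ-PINCH ROW (split), DISPLAY FORM, on the `κ₁`-CERTIFICATE: `BSDp W 2`** from PRINT {A236 `h41sp`,
`hmod`, `hGZK`, `h414`, `hC`} + MEMO {K11 `hKato`} + CERT {`hκ`, tower gap, layer count, `λ_an = n + 1`, `μ_an = 0`}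
+ `Irr W 2` + {`Mult W 2`, split, `r_an = 0`}; `htors` (`TowerClass.not_two_dvd_torsionOrder_of_irr`) and `hper₀`
(Česnavičius) discharged. No `hGS`. [cite: Kato2004Asterisque, Thm. 17.4 (p. 273) and 17.13]
[cite: GreenbergLNM1716, §4 pp. 112–113 (split l_v) and Prop. 4.14 (p. 124)] [cite: Cesnavicius2018, Thm. 1.2]
[cite: Miller2011LMS, Def. 1.1] -/
theorem bsdp_two_split_of_katoRat_of_towerGap_display_of_kappaCert {j n : ℕ}
    (hKato : O1.KatoMultiplicativeDivisibilityRat W 2)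
    (h41sp : thm41Analogue_charValue_rankZero_split_baseChange_anyPrime)
    (hκ : AnalyticKappaOneValuationAtTwo W)
    (hmod : nonempty_modularParametrizationData)
    (hGZK : rank_eq_analyticRank_of_analyticRank_le_one)
    (h414 : prop414_noFiniteSubmodule_of_not_dvd_torsionOrder)
    (hC : cesnavicius_not_two_dvd_maninConstant_of_two_dvd_level)
    (hgap : TowerGapAtTwo W) (hirr : Irr W 2)
    (hr : W.analyticRank = 0) (hmult : Mult W 2) (hsp : W.HasSplitMultiplicativeReductionAtPrime 2)
    (hlan : X2.AnalyticLambdaEq W 2 (n + 1)) (hμan : X2.AnalyticMuLE W 2 0)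
    (hsel : ∀ κ : ZpExtension ℚ 2, κ.IsCyclotomic →
      2 ^ n ≤ Nat.card {z : W.selmerLayer κ j // 2 • z = 0}) : BSDp W 2 :=
  bsdp_two_split_of_katoRat_of_towerGap_of_layerSelmer_of_kappaCert W hKato h41sp hκ hmod hGZK h414
    (periodRatio_nonneg_of_irr_of_cesnavicius W hC hmult hirr) hgap
    (TowerClass.not_two_dvd_torsionOrder_of_irr W hirr) hr hmult hsp hlan hμan hsel

end Summit.BirchSwinnertonDyer.BirchSwinnertonDyer.Theorems.MultSelmerRank

end
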